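import Literature.MathematicalPhysics.QuantumLattice.XXZAntiferromagnetGroundStateOrder
import Literature.MathematicalPhysics.QuantumLattice.HeisenbergOrderNeelProofs
import HarnessLib

/-!
# The isotropic point: Néel order of the Heisenberg antiferromagnet is the `Δ = 1` member of the XXZ family

Topic `MathematicalPhysics/QuantumLattice`; a short companion of `XXZAntiferromagnetGroundStateOrder.lean`
(staggered order of the XXZ antiferromagnet `xxzHamiltonian n (torusGraph d L) J Δ` in the windows
`Δ ≥ 5/2` and `0 ≤ Δ ≤ 0.15`) and of `HeisenbergOrder.lean` (the Néel-order vocabulary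
`groundStateSpinCorrTorus`, `HasStaggeredEvenTorusLRO` of `kennedy_lieb_shastry_ground`, whose excluded
case `(d, S) = (2, ½)` is the open problem of Néel order for the square-lattice spin-½ Heisenberg
antiferromagnet).

Content (textbook; Tasaki 2020 §2.4: the XXZ model at `Δ = 1` IS the Heisenberg model; Kennedy–Lieb–
Shastry 1988 p. 1021: by `SU(2)` invariance of the ground-state functional all three components of
`⟨𝐒_x·𝐒_y⟩` coincide, "the factor 3 from the three components"):

* (private) `xxzHamiltonian_one_eq_heisenbergHamiltonian` — `xxzHamiltonian n G J 1 = heisenbergHamiltonian n G J`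
  (also proved locally in `Summits/AtomisticToContinuum/…` files, which Literature cannot import);
* `groundStateSpinCorrTorus_eq_three_mul_xxz` — for `J > 0`,
  `⟨𝐒_x·𝐒_y⟩_GS = 3 · Re ω_GS(Sᶻ_xSᶻ_y)`, i.e. `groundStateSpinCorrTorus L n J x y = 3 · groundStateXXZCorrTorus 2 L n J 1 x y`;
* `hasStaggeredEvenTorusLRO_heisenberg_iff_xxz_two` — consequently Néel order in the sense of
  `HeisenbergOrder.lean` (staggered LRO of `⟨𝐒_x·𝐒_y⟩_GS` along even tori) holds IFF the `z–z`
  ground-state correlation of `xxzHamiltonian n (torusGraph d L) J 1` has staggered long-range order —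
  the `Δ = 1` member of the family `Δ ↦ HasStaggeredEvenTorusLRO (groundStateXXZCorrTorus 2 · n J Δ)`
  which `xxzAF_ground_neel_spinHalf` PROVES for `n = 1`, `d = 2`, `Δ ≥ 5/2` (and whose planar analogue
  `xxzAF_ground_planar_spinHalf` holds for `0 ≤ Δ ≤ 0.15`). The isotropic point itself is not touched.

A bounded-sequence lemma `pos_liminf_const_mul_iff` (positivity of `liminf` is invariant under a
positive rescaling) carries the factor `3` through the `liminf`.

## References

* [Tasaki2020] H. Tasaki, *Physics and Mathematics of Quantum Many-Body Systems*, Springer 2020, §2.4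
  (Heisenberg and XXZ Hamiltonians; `SU(2)` and `U(1)` symmetry).
* [KLS1988JSP] T. Kennedy, E. H. Lieb, B. S. Shastry, J. Stat. Phys. 53 (1988) 1019, p. 1021.
* [DysonLiebSimon1978] F. J. Dyson, E. H. Lieb, B. Simon, J. Stat. Phys. 18 (1978) 335, §1 (staggered order).
-/

noncomputable section

open Matrix Finset Filter Topology
open scoped ComplexOrder
open Literature.MathematicalPhysics.QuantumLattice Literature.MathematicalPhysics.QuantumLattice.SpinOperators
  Literature.Probability.LatticeModels

namespace Literature.MathematicalPhysics.QuantumLattice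

variable {d : ℕ}

/-! ### `Δ = 1` is the Heisenberg model -/

/-- **The XXZ model at `Δ = 1` is the Heisenberg model**: `J Σ_e (b⁰ + b¹ + 1·b²) = J Σ_e 𝐒_x·𝐒_y`.
(Private: the same identity is proved locally in two `Summits/AtomisticToContinuum/…` files as
`xxzHamiltonian_one_eq_heisenberg`, which Literature cannot import; kept private here to avoid a
duplicate public declaration.) [cite: Tasaki2020, §2.4 (remarks after eq. (2.4.1))] -/
private theorem xxzHamiltonian_one_eq_heisenbergHamiltonian {Λ : Type*} [Fintype Λ] [DecidableEq Λ] (n : ℕ)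
    (G : SimpleGraph Λ) [DecidableRel G.Adj] (J : ℝ) :
    xxzHamiltonian n G J 1 = heisenbergHamiltonian n G J := by
  rw [xxzHamiltonian, heisenbergHamiltonian]
  congr 1
  refine sum_congr rfl fun e _ => ?_
  induction e using Sym2.ind with
  | h x y =>
    simp only [Sym2.lift_mk, spinDotSym_mk, spinDot, Fin.sum_univ_three, Complex.ofReal_one, one_smul]

/-- **The `z–z` XXZ correlation at `Δ = 1` is the Heisenberg two-point function** (`J > 0`; the
ground-state functional of `J·H₁` is that of `H₁`):
`groundStateXXZCorrTorus 2 L n J 1 x y = heisGroundCorr 2 L n x y`. [cite: KLS1988JSP, p. 1021] -/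
theorem groundStateXXZCorrTorus_two_one_eq_heisGroundCorr (L n : ℕ) {J : ℝ} (hJ : 0 < J)
    (x y : TorusSite d L) :
    groundStateXXZCorrTorus 2 L n J 1 x y = heisGroundCorr 2 L n x y := by
  rcases Nat.eq_zero_or_pos L with rfl | hL
  · simp
  · haveI : NeZero L := ⟨hL.ne'⟩
    rw [groundStateXXZCorrTorus_of_neZero, heisGroundCorr_of_neZero,
      xxzHamiltonian_one_eq_heisenbergHamiltonian]
    change ((heisenbergTorus d L n J).groundStateFunctional _).re = _
    rw [heisenbergTorus_eq_smul,
      Matrix.groundStateFunctional_smul_of_pos (heisenbergTorus_isHermitian d L n 1) hJ]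

/-- **`⟨𝐒_x·𝐒_y⟩_GS = 3 · Re ω_GS(Sᶻ_xSᶻ_y)`** for the Heisenberg antiferromagnet (`J > 0`): the three
components of the ground-state correlation coincide by `SU(2)` invariance (`heisGroundCorr_eq_zero_comp`),
"the factor 3 from the three components". In the XXZ vocabulary:
`groundStateSpinCorrTorus L n J x y = 3 · groundStateXXZCorrTorus 2 L n J 1 x y`.
[cite: KLS1988JSP, p. 1021] [cite: Tasaki2020, §2.4] -/
theorem groundStateSpinCorrTorus_eq_three_mul_xxz (L n : ℕ) {J : ℝ} (hJ : 0 < J) (x y : TorusSite d L) :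
    groundStateSpinCorrTorus L n J x y = 3 * groundStateXXZCorrTorus 2 L n J 1 x y := by
  rw [groundStateSpinCorrTorus_eq_sum L n hJ x y, groundStateXXZCorrTorus_two_one_eq_heisGroundCorr L n hJ,
    Fin.sum_univ_three, heisGroundCorr_eq_zero_comp 1, heisGroundCorr_eq_zero_comp 2]
  ring

/-- A priori bound `|Re ω_GS(S^α_xS^α_y)| ≤ S²` for the XXZ ground-state correlation (all sides,
including the junk side). [cite: Tasaki2020, §2.1 (‖S^α‖ = S)] -/
theorem groundStateXXZCorrTorus_abs_le (α : Fin 3) (L n : ℕ) (J Δ : ℝ) (x y : TorusSite d L) :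
    |groundStateXXZCorrTorus α L n J Δ x y| ≤ ((n : ℝ) / 2) ^ 2 := by
  rcases Nat.eq_zero_or_pos L with rfl | hL
  · rw [groundStateXXZCorrTorus_zero_side, abs_zero]; positivity
  · haveI : NeZero L := ⟨hL.ne'⟩
    rw [groundStateXXZCorrTorus_of_neZero]
    exact abs_re_groundStateFunctional_siteSpin_mul_le (xxzHamiltonian_isHermitian n _ J Δ) α x y

/-! ### Positivity of a `liminf` is invariant under positive rescaling -/

/-- For a bounded real sequence `s` and `c > 0`: `0 < liminf (c·s)` iff `0 < liminf s`
(`x ↦ c x` is an order isomorphism of `ℝ`, which commutes with `liminf` on bounded sequences).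
[cite: DysonLiebSimon1978, §1 (the order parameter is defined up to normalisation)] -/
theorem pos_liminf_const_mul_iff {s : ℕ → ℝ} {c M : ℝ} (hc : 0 < c) (hM : ∀ k, |s k| ≤ M) :
    0 < liminf (fun k => c * s k) atTop ↔ 0 < liminf s atTop := by
  have hlo : ∀ k, -M ≤ s k := fun k => (abs_le.1 (hM k)).1
  have hhi : ∀ k, s k ≤ M := fun k => (abs_le.1 (hM k)).2
  have key : (OrderIso.mulLeft₀ c hc) (liminf s atTop) = liminf (fun k => (OrderIso.mulLeft₀ c hc) (s k)) atTop :=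
    OrderIso.liminf_apply (OrderIso.mulLeft₀ c hc)
      (isBoundedUnder_of ⟨-M, fun k => hlo k⟩)
      (isCoboundedUnder_ge_of_le atTop hhi)
      (isBoundedUnder_of ⟨c * -M, fun k => by
        show c * -M ≤ (OrderIso.mulLeft₀ c hc) (s k)
        rw [OrderIso.mulLeft₀_apply]
        exact mul_le_mul_of_nonneg_left (hlo k) hc.le⟩)
      (isCoboundedUnder_ge_of_le atTop (x := c * M) fun k => by
        show (OrderIso.mulLeft₀ c hc) (s k) ≤ c * M
        rw [OrderIso.mulLeft₀_apply]
        exact mul_le_mul_of_nonneg_left (hhi k) hc.le)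
  simp only [OrderIso.mulLeft₀_apply] at key
  rw [← key]
  exact mul_pos_iff_of_pos_left hc

/-! ### Néel order of the Heisenberg model ⇔ staggered `z`-order of the XXZ model at `Δ = 1` -/

/-- **Néel order in the sense of `HeisenbergOrder.lean` is staggered `z`-order of the XXZ model at
`Δ = 1`.** For every `d`, spin `n/2` and `J > 0`:
`HasStaggeredEvenTorusLRO (⟨𝐒_x·𝐒_y⟩_GS) ↔ HasStaggeredEvenTorusLRO (Re ω_GS(Sᶻ_xSᶻ_y) of xxzHamiltonian · J 1)`
(the two staggered sums differ by the factor `3`). At `(d, n) = (2, 1)` the left side for all `J > 0` is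
the OPEN Néel-order statement for the square-lattice spin-½ Heisenberg antiferromagnet; the right side
is the `Δ = 1` member of the family proved by `xxzAF_ground_neel_spinHalf` for `Δ ≥ 5/2`.
[cite: KLS1988JSP, p. 1021] [cite: DysonLiebSimon1978, §1] -/
theorem hasStaggeredEvenTorusLRO_heisenberg_iff_xxz_two (n : ℕ) {J : ℝ} (hJ : 0 < J) :
    HasStaggeredEvenTorusLRO (fun L x y => groundStateSpinCorrTorus (d := d) L n J x y) ↔
      HasStaggeredEvenTorusLRO (fun L x y => groundStateXXZCorrTorus 2 (d := d) L n J 1 x y) := by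
  unfold HasStaggeredEvenTorusLRO HasStaggeredLongRangeOrder HasLongRangeOrder
  -- the Heisenberg sequence is `3 ×` the XXZ sequence
  set s : ℕ → ℝ := fun k => (∑ x ∈ halfOpenBox d (2 * k), ∑ y ∈ halfOpenBox d (2 * k),
      latticeStagger x * latticeStagger y *
        torusPullback (fun L x y => groundStateXXZCorrTorus 2 (d := d) L n J 1 x y) (2 * k) x y) /
      ((halfOpenBox d (2 * k)).card : ℝ) ^ 2 with hs
  have hfun : (fun k : ℕ => (∑ x ∈ halfOpenBox d (2 * k), ∑ y ∈ halfOpenBox d (2 * k),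
      latticeStagger x * latticeStagger y *
        torusPullback (fun L x y => groundStateSpinCorrTorus (d := d) L n J x y) (2 * k) x y) /
      ((halfOpenBox d (2 * k)).card : ℝ) ^ 2) = fun k => 3 * s k := by
    funext k
    rw [hs]
    dsimp only
    rw [mul_div_assoc', mul_sum]
    congr 1
    refine sum_congr rfl fun x _ => ?_
    rw [mul_sum]
    refine sum_congr rfl fun y _ => ?_
    rw [torusPullback_apply, torusPullback_apply, groundStateSpinCorrTorus_eq_three_mul_xxz _ n hJ]
    ring
  rw [hfun]
  -- the XXZ sequence is bounded by `S²`
  have hB : ∀ k, |s k| ≤ ((n : ℝ) / 2) ^ 2 := by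
    intro k
    rw [hs]
    dsimp only
    have hterm : ∀ x y : Site d, |latticeStagger x * latticeStagger y *
        torusPullback (fun L x y => groundStateXXZCorrTorus 2 (d := d) L n J 1 x y) (2 * k) x y| ≤
        ((n : ℝ) / 2) ^ 2 := by
      intro x y
      rw [abs_mul, abs_mul, latticeStagger_apply, latticeStagger_apply, abs_neg_one_pow, abs_neg_one_pow,
        one_mul, one_mul, torusPullback_apply]
      exact groundStateXXZCorrTorus_abs_le 2 (2 * k) n J 1 _ _
    have hcard : (0 : ℝ) ≤ ((halfOpenBox d (2 * k)).card : ℝ) ^ 2 := by positivity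
    rcases hcard.eq_or_lt with h0 | hpos
    · rw [← h0, div_zero, abs_zero]; positivity
    · rw [abs_div, abs_of_pos hpos, div_le_iff₀ hpos]
      calc |∑ x ∈ halfOpenBox d (2 * k), ∑ y ∈ halfOpenBox d (2 * k),
              latticeStagger x * latticeStagger y *
                torusPullback (fun L x y => groundStateXXZCorrTorus 2 (d := d) L n J 1 x y) (2 * k) x y|
          ≤ ∑ x ∈ halfOpenBox d (2 * k), ∑ y ∈ halfOpenBox d (2 * k), ((n : ℝ) / 2) ^ 2 := by
            refine (abs_sum_le_sum_abs _ _).trans (sum_le_sum fun x _ => ?_)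
            exact (abs_sum_le_sum_abs _ _).trans (sum_le_sum fun y _ => hterm x y)
        _ = ((n : ℝ) / 2) ^ 2 * ((halfOpenBox d (2 * k)).card : ℝ) ^ 2 := by
            rw [sum_const, sum_const, nsmul_eq_mul, nsmul_eq_mul]; ring
  exact pos_liminf_const_mul_iff (by norm_num : (0 : ℝ) < 3) hB

end Literature.MathematicalPhysics.QuantumLattice

end
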